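import Summits.QuantumFields.YangMills.Theorems.FluctuationComparisonRegPrIntLS2BetaConeOnCube
import Summits.QuantumFields.YangMills.Theorems.FluctuationComparisonRegPrIntLS2BetaCubeOffsetAlgebra
import Summits.QuantumFields.YangMills.Theorems.FluctuationComparisonRegPrIntLS2BetaConeOnRectangle
import HarnessLib

/-!
# S2β · D-GUARD ∕ (BG∞) — THE CONE ON A DISCRETE BOX ((R2-S) of FINDING (BX): `hSec`'s class-3 blocks are boxes `{0..n₁} × {0..n₂} × {0..n₃}` with sides in
# `{c, c+1}`; the landed cube cone ✓p839993 `exists_coneOnCube` on `{0..n₁}³` (`n₁` the longest side) is transported to the box by TWO monotone stretches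
# ✓p840271 (`ψ (i, k, l) := φ (i, σ₂ k, σ₃ l)`, `W φ (i, j, l) := Wc ψ (i, τ₂ j, τ₃ l)`), with the shell letters taken PER BOND (what (L-Σ)'s `h₃` has) and
# ✓p840009 S0 applied inside via ✓p840187 `shellAdj_of_steps` (px5 g24's ✓p840356 (R2) «cone on a rectangle» ONE DIMENSION UP)

Cell `ym3-torus` (YM ladder rung R3 = continuum `SU(2)` Yang–Mills on the three-torus at fixed lattice data — a RUNG: NOT d = 4, NOT infinite volume,
NOT a mass gap, NOT Clay).  Width seat «width 8» `ym3-torus-px8` (gen 28, toron∕flux lineage ✓p826411 → px17 (W1) ✓p837971), FREE px helper on crux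
`stmt-QuantumFields-20520`; `--kind proof --supports stmt-QuantumFields-20520 --as helper`, count-neutral, DEFINITION-FREE (0 `def`, 0 `instance`, 0 `notation`,
0 `sorry`, default heartbeats).  The banked (RECT) road of desk RULING №132-A for the S-lane, cut because px19 g25's `hSec_of_fillings` letter `h₃` (STATUS
2026-09-01T02:55:11Z) is PER-AXIS (`n : Fin P.d → ℕ`); architect px17 g23 02:30:13Z confirmed (BX) and the stretch repair («box = the same on two axes»).

WHY.  ✓`exists_parityBlocks` cuts `ZMod N` into intervals of lengths `c` and `c + 1`, the same partition on every axis, so a class-3 block is a box with sides in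
`{c, c+1}` — not a cube in general.  Naming `n₁` the longest side (`n₂, n₃ ≤ n₁ ≤ 2n₂, 2n₃`), the compressions `σ₂ : {0..n₁} → {0..n₂}`, `σ₃ : {0..n₁} → {0..n₃}`
(unit steps, ends to ends) pull the box's shell data back to cube shell data `ψ` with the SAME per-bond oscillation (a `σ`-step is `0` or `1`, and a cube-shell bond
maps onto a box face), the cube cone `Wc ψ` of ✓S2 is read back through the stretches `τ₂, τ₃` (steps `≤ 2`, `σ ∘ τ = id`).  Shell agreement by `σ (τ j) = j` and
`τ {0, n_k} = {0, n₁}`; cap position verbatim; first-direction steps = cube steps, second∕third-direction steps ≤ two cube steps (✓(R2) `dist1_two_steps_le`);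
datum-to-datum closeness verbatim.  Cube steps: per-bond `η` ⟹ (✓`shellAdj_of_steps`, ✓S0 `dist1_shell_le_two_mul_l1`) modulus `2η` ⟹ (S2 (iii)) `12Λη + 3(π−r)∕n₁`;
box steps `≤ 24Λη + 6(π−r)∕n₁`, `Λ = (π − r)∕sin r`.

WHAT IS PROVED (sorry-free; «shell» of the box = `i ≤ n₁ ∧ j ≤ n₂ ∧ l ≤ n₃ ∧ (i = 0 ∨ i = n₁ ∨ j = 0 ∨ j = n₂ ∨ l = 0 ∨ l = n₃)`).
* §1 `boxShell_of_cubeShell`, `cubeShell_h1_of_box`, `cubeShell_h2_of_box`, `cubeShell_h3_of_box` (the cube shell letters of `ψ` from the box's; any `[GaugeGroup G]`).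
* §2 ★★★ `exists_coneOnBox (n₁ n₂ n₃) (hn₂ : 2 ≤ n₂) (hn₃ : 2 ≤ n₃) (h₂₁ : n₂ ≤ n₁) (h₁₂ : n₁ ≤ 2·n₂) (h₃₁ : n₃ ≤ n₁) (h₁₃ : n₁ ≤ 2·n₃) (hr : 0 < r) (hrπ : r < π) (a) :
  ∃ W : (ℕ × ℕ × ℕ → SU2) → (ℕ × ℕ × ℕ → SU2), ∀ φ, shell cap → (i) `W φ = φ` on the shell ∧ (ii) `‖logVec (a⁻¹·W φ (i,j,l))‖ ≤ π − r` on the box ∧ (iii′) `∀ η ≥ 0`,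
  PER-BOND shell oscillation `≤ η` (the three forward families) ⟹ the three lattice steps `≤ 24Λη + 6(π−r)∕n₁` ∧ (iv) shell caps for `φ′` and shell-pointwise
  `dist1 (φ·φ′⁻¹) ≤ μ` ⟹ pointwise `dist1 (W φ·(W φ′)⁻¹) ≤ Λμ`.`

HONEST SCOPE.  Transport of landed sphere∕lattice geometry (✓p839993, ✓p840009, ✓p840187, ✓p840356 §1) by arithmetic (✓p840271); no gauge field; nothing of
Bałaban's renormalisation-group analysis is asserted or proved ([Balaban1985RegularSpaces] Thm 2 p.83 — local small gauges).  `hSec` ∕ `h₃` ∕ (BG∞) ∕ `hBG` are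
HYPOTHESES∕CONJECTURES (plan §116) and NOT proved; GAP♯∘ (registry v11 UNTOUCHED), the five registered stubs (0∕5), S2β, 20520, 19936, 19200, `YM3TorusSU2` are NOT
proved; no registered stub is closed; rung R3 — NOT d = 4, NOT infinite volume, NOT a mass gap, NOT Clay; the Yang–Mills mass gap is NOT proved.  Axioms standard.

References: T. Bałaban, CMP **99** (1985) 75–102 [Balaban1985RegularSpaces] (Thm 2 p.83).
-/

set_option autoImplicit false

noncomputable section

namespace Summit.QuantumFields.YangMills.Theorems.FluctuationComparisonRegPrIntLS2BetaConeOnBox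

open scoped Real
open Literature.MathematicalPhysics.QuantumLattice (su2Quat)
open Literature.MathematicalPhysics.QuantumFieldTheory.Balaban1983to89
open T4CubeChartGnomonic (SU2)
open T4ExpWindowSmallField (logVec)
open Summit.QuantumFields.YangMills.Theorems.FluctuationComparisonRegPrIntLS2BetaConeOnCube (exists_coneOnCube)
open Summit.QuantumFields.YangMills.Theorems.FluctuationComparisonRegPrIntLS2BetaCubeShellModulus (dist1_shell_le_two_mul_l1)
open Summit.QuantumFields.YangMills.Theorems.FluctuationComparisonRegPrIntLS2BetaCubeOffsetAlgebra (shellAdj_of_steps)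
open Summit.QuantumFields.YangMills.Theorems.FluctuationComparisonRegPrIntLS2BetaConeOnRectangle (dist1_two_steps_le)
open Summit.QuantumFields.YangMills.Theorems.FluctuationComparisonRegPrIntLS2BetaMonotoneStretch (exists_stretch)

/-! ## §1 The cube datum of a box datum: shell and letters -/

/-- The box shell of the `σ`-image of a cube-shell point (`σ₂ {0, n₁} = {0, n₂}`, `σ₃ {0, n₁} = {0, n₃}`). [folklore] -/
theorem boxShell_of_cubeShell {n₁ n₂ n₃ : ℕ} (σ₂ σ₃ : ℕ → ℕ) (h₂0 : σ₂ 0 = 0) (h₂a : σ₂ n₁ = n₂) (h₃0 : σ₃ 0 = 0) (h₃a : σ₃ n₁ = n₃)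
    {i k l : ℕ} (hb : i = 0 ∨ i = n₁ ∨ k = 0 ∨ k = n₁ ∨ l = 0 ∨ l = n₁) :
    i = 0 ∨ i = n₁ ∨ σ₂ k = 0 ∨ σ₂ k = n₂ ∨ σ₃ l = 0 ∨ σ₃ l = n₃ := by
  rcases hb with h | h | h | h | h | h
  · exact Or.inl h
  · exact Or.inr (Or.inl h)
  · exact Or.inr (Or.inr (Or.inl (by rw [h, h₂0])))
  · exact Or.inr (Or.inr (Or.inr (Or.inl (by rw [h, h₂a]))))
  · exact Or.inr (Or.inr (Or.inr (Or.inr (Or.inl (by rw [h, h₃0])))))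
  · exact Or.inr (Or.inr (Or.inr (Or.inr (Or.inr (by rw [h, h₃a])))))

/-- **The cube's first-direction shell letters from the box's** (`ψ (i, k, l) := φ (i, σ₂ k, σ₃ l)`): a forward `i`-bond of the cube shell is a forward `i`-bond of
the box shell. [folklore] -/
theorem cubeShell_h1_of_box {G : Type*} [GaugeGroup G] (n₁ n₂ n₃ : ℕ) (φ : ℕ × ℕ × ℕ → G) (σ₂ σ₃ : ℕ → ℕ)
    (h₂0 : σ₂ 0 = 0) (h₂a : σ₂ n₁ = n₂) (h₂le : ∀ j, j ≤ n₁ → σ₂ j ≤ n₂) (h₃0 : σ₃ 0 = 0) (h₃a : σ₃ n₁ = n₃) (h₃le : ∀ j, j ≤ n₁ → σ₃ j ≤ n₃) {η : ℝ}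
    (H1 : ∀ i j l, i + 1 ≤ n₁ → j ≤ n₂ → l ≤ n₃ → (i = 0 ∨ i = n₁ ∨ j = 0 ∨ j = n₂ ∨ l = 0 ∨ l = n₃) →
      (i + 1 = n₁ ∨ j = 0 ∨ j = n₂ ∨ l = 0 ∨ l = n₃) → dist1 (φ (i, j, l) * (φ (i + 1, j, l))⁻¹) ≤ η) :
    ∀ i k l, i + 1 ≤ n₁ → k ≤ n₁ → l ≤ n₁ → (i = 0 ∨ i = n₁ ∨ k = 0 ∨ k = n₁ ∨ l = 0 ∨ l = n₁) →
      (i + 1 = n₁ ∨ k = 0 ∨ k = n₁ ∨ l = 0 ∨ l = n₁) →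
      dist1 ((fun q : ℕ × ℕ × ℕ => φ (q.1, σ₂ q.2.1, σ₃ q.2.2)) (i, k, l) *
        ((fun q : ℕ × ℕ × ℕ => φ (q.1, σ₂ q.2.1, σ₃ q.2.2)) (i + 1, k, l))⁻¹) ≤ η := by
  intro i k l hi hk hl hb hb'
  have hb2 := boxShell_of_cubeShell (n₂ := n₂) (n₃ := n₃) σ₂ σ₃ h₂0 h₂a h₃0 h₃a hb
  have hb2' : i + 1 = n₁ ∨ σ₂ k = 0 ∨ σ₂ k = n₂ ∨ σ₃ l = 0 ∨ σ₃ l = n₃ :=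
    (boxShell_of_cubeShell (i := i + 1) (n₂ := n₂) (n₃ := n₃) σ₂ σ₃ h₂0 h₂a h₃0 h₃a (Or.inr hb')).elim
      (fun h => absurd h (by omega)) id
  exact H1 i (σ₂ k) (σ₃ l) hi (h₂le k hk) (h₃le l hl) hb2 hb2'

/-- **The cube's second-direction shell letters from the box's**: a `σ₂`-step is `0` (letter `dist1 1 = 0`) or `1` (a forward `j`-bond of the box shell; `n₁ ≥ 2`). [folklore] -/
theorem cubeShell_h2_of_box {G : Type*} [GaugeGroup G] (n₁ n₂ n₃ : ℕ) (hn : 2 ≤ n₁) (φ : ℕ × ℕ × ℕ → G) (σ₂ σ₃ : ℕ → ℕ)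
    (h₂m : ∀ j, σ₂ j ≤ σ₂ (j + 1)) (h₂s : ∀ j, σ₂ (j + 1) ≤ σ₂ j + 1) (h₂le : ∀ j, j ≤ n₁ → σ₂ j ≤ n₂)
    (h₃0 : σ₃ 0 = 0) (h₃a : σ₃ n₁ = n₃) (h₃le : ∀ j, j ≤ n₁ → σ₃ j ≤ n₃) {η : ℝ} (hη : 0 ≤ η)
    (H2 : ∀ i j l, i ≤ n₁ → j + 1 ≤ n₂ → l ≤ n₃ → (i = 0 ∨ i = n₁ ∨ j = 0 ∨ j = n₂ ∨ l = 0 ∨ l = n₃) →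
      (i = 0 ∨ i = n₁ ∨ j + 1 = n₂ ∨ l = 0 ∨ l = n₃) → dist1 (φ (i, j, l) * (φ (i, j + 1, l))⁻¹) ≤ η) :
    ∀ i k l, i ≤ n₁ → k + 1 ≤ n₁ → l ≤ n₁ → (i = 0 ∨ i = n₁ ∨ k = 0 ∨ k = n₁ ∨ l = 0 ∨ l = n₁) →
      (i = 0 ∨ i = n₁ ∨ k + 1 = n₁ ∨ l = 0 ∨ l = n₁) →
      dist1 ((fun q : ℕ × ℕ × ℕ => φ (q.1, σ₂ q.2.1, σ₃ q.2.2)) (i, k, l) *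
        ((fun q : ℕ × ℕ × ℕ => φ (q.1, σ₂ q.2.1, σ₃ q.2.2)) (i, k + 1, l))⁻¹) ≤ η := by
  intro i k l hi hk hl hb hb'
  show dist1 (φ (i, σ₂ k, σ₃ l) * (φ (i, σ₂ (k + 1), σ₃ l))⁻¹) ≤ η
  rcases (show σ₂ (k + 1) = σ₂ k ∨ σ₂ (k + 1) = σ₂ k + 1 by have := h₂m k; have := h₂s k; omega) with h | h
  · rw [h, mul_inv_cancel, GaugeGroup.dist1_one]; exact hη
  rw [h]
  have hk1 : σ₂ k + 1 ≤ n₂ := by have := h₂le (k + 1) hk; omega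
  -- the bond lies on an `i`-face or an `l`-face of the cube (else `k = 0 ∧ k + 1 = n₁`, impossible for `n₁ ≥ 2`)
  have hface : (i = 0 ∨ i = n₁) ∨ (l = 0 ∨ l = n₁) := by
    rcases hb with h0 | h0 | h0 | h0 | h0 | h0
    · exact Or.inl (Or.inl h0)
    · exact Or.inl (Or.inr h0)
    · rcases hb' with h1 | h1 | h1 | h1 | h1
      · exact Or.inl (Or.inl h1)
      · exact Or.inl (Or.inr h1)
      · exfalso; omega
      · exact Or.inr (Or.inl h1)
      · exact Or.inr (Or.inr h1)
    · exfalso; omega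
    · exact Or.inr (Or.inl h0)
    · exact Or.inr (Or.inr h0)
  rcases hface with (h0 | h0) | (h0 | h0)
  · exact H2 i (σ₂ k) (σ₃ l) hi hk1 (h₃le l hl) (Or.inl h0) (Or.inl h0)
  · exact H2 i (σ₂ k) (σ₃ l) hi hk1 (h₃le l hl) (Or.inr (Or.inl h0)) (Or.inr (Or.inl h0))
  · have h3 : σ₃ l = 0 := by rw [h0, h₃0]
    exact H2 i (σ₂ k) (σ₃ l) hi hk1 (h₃le l hl) (Or.inr (Or.inr (Or.inr (Or.inr (Or.inl h3))))) (Or.inr (Or.inr (Or.inr (Or.inl h3))))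
  · have h3 : σ₃ l = n₃ := by rw [h0, h₃a]
    exact H2 i (σ₂ k) (σ₃ l) hi hk1 (h₃le l hl) (Or.inr (Or.inr (Or.inr (Or.inr (Or.inr h3))))) (Or.inr (Or.inr (Or.inr (Or.inr h3))))

/-- **The cube's third-direction shell letters from the box's** (the same with the roles of `σ₂`, `σ₃` exchanged). [folklore] -/
theorem cubeShell_h3_of_box {G : Type*} [GaugeGroup G] (n₁ n₂ n₃ : ℕ) (hn : 2 ≤ n₁) (φ : ℕ × ℕ × ℕ → G) (σ₂ σ₃ : ℕ → ℕ)
    (h₂0 : σ₂ 0 = 0) (h₂a : σ₂ n₁ = n₂) (h₂le : ∀ j, j ≤ n₁ → σ₂ j ≤ n₂)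
    (h₃m : ∀ j, σ₃ j ≤ σ₃ (j + 1)) (h₃s : ∀ j, σ₃ (j + 1) ≤ σ₃ j + 1) (h₃le : ∀ j, j ≤ n₁ → σ₃ j ≤ n₃) {η : ℝ} (hη : 0 ≤ η)
    (H3 : ∀ i j l, i ≤ n₁ → j ≤ n₂ → l + 1 ≤ n₃ → (i = 0 ∨ i = n₁ ∨ j = 0 ∨ j = n₂ ∨ l = 0 ∨ l = n₃) →
      (i = 0 ∨ i = n₁ ∨ j = 0 ∨ j = n₂ ∨ l + 1 = n₃) → dist1 (φ (i, j, l) * (φ (i, j, l + 1))⁻¹) ≤ η) :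
    ∀ i k l, i ≤ n₁ → k ≤ n₁ → l + 1 ≤ n₁ → (i = 0 ∨ i = n₁ ∨ k = 0 ∨ k = n₁ ∨ l = 0 ∨ l = n₁) →
      (i = 0 ∨ i = n₁ ∨ k = 0 ∨ k = n₁ ∨ l + 1 = n₁) →
      dist1 ((fun q : ℕ × ℕ × ℕ => φ (q.1, σ₂ q.2.1, σ₃ q.2.2)) (i, k, l) *
        ((fun q : ℕ × ℕ × ℕ => φ (q.1, σ₂ q.2.1, σ₃ q.2.2)) (i, k, l + 1))⁻¹) ≤ η := by
  intro i k l hi hk hl hb hb'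
  show dist1 (φ (i, σ₂ k, σ₃ l) * (φ (i, σ₂ k, σ₃ (l + 1)))⁻¹) ≤ η
  rcases (show σ₃ (l + 1) = σ₃ l ∨ σ₃ (l + 1) = σ₃ l + 1 by have := h₃m l; have := h₃s l; omega) with h | h
  · rw [h, mul_inv_cancel, GaugeGroup.dist1_one]; exact hη
  rw [h]
  have hl1 : σ₃ l + 1 ≤ n₃ := by have := h₃le (l + 1) hl; omega
  have hface : (i = 0 ∨ i = n₁) ∨ (k = 0 ∨ k = n₁) := by
    rcases hb with h0 | h0 | h0 | h0 | h0 | h0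
    · exact Or.inl (Or.inl h0)
    · exact Or.inl (Or.inr h0)
    · exact Or.inr (Or.inl h0)
    · exact Or.inr (Or.inr h0)
    · rcases hb' with h1 | h1 | h1 | h1 | h1
      · exact Or.inl (Or.inl h1)
      · exact Or.inl (Or.inr h1)
      · exact Or.inr (Or.inl h1)
      · exact Or.inr (Or.inr h1)
      · exfalso; omega
    · exfalso; omega
  rcases hface with (h0 | h0) | (h0 | h0)
  · exact H3 i (σ₂ k) (σ₃ l) hi (h₂le k hk) hl1 (Or.inl h0) (Or.inl h0)
  · exact H3 i (σ₂ k) (σ₃ l) hi (h₂le k hk) hl1 (Or.inr (Or.inl h0)) (Or.inr (Or.inl h0))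
  · have h2 : σ₂ k = 0 := by rw [h0, h₂0]
    exact H3 i (σ₂ k) (σ₃ l) hi (h₂le k hk) hl1 (Or.inr (Or.inr (Or.inl h2))) (Or.inr (Or.inr (Or.inl h2)))
  · have h2 : σ₂ k = n₂ := by rw [h0, h₂a]
    exact H3 i (σ₂ k) (σ₃ l) hi (h₂le k hk) hl1 (Or.inr (Or.inr (Or.inr (Or.inl h2)))) (Or.inr (Or.inr (Or.inr (Or.inl h2))))

/-! ## §2 The cone on the box -/

/-- ★★★ **THE CONE ON A DISCRETE BOX (STAGE S ON A BOX-BLOCK)**: for `2 ≤ n₂, n₃ ≤ n₁ ≤ 2n₂, 2n₃`, `0 < r < π` and a centre `a` there is an OPERATOR `W` on data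
`φ : ℕ × ℕ × ℕ → SU2` such that for every `φ` whose shell values (shell of `{0..n₁} × {0..n₂} × {0..n₃}`) lie within arc `π − r` of `a`: (i) `W φ = φ` on the shell,
(ii) `W φ` stays within arc `π − r` of `a` on the box, (iii′) for every `η ≥ 0` bounding the data's three families of forward shell bonds, the three lattice steps of
`W φ` are `≤ 24·((π−r)∕sin r)·η + 6·(π−r)∕n₁`, and (iv) two data pointwise `μ`-close on the shell have fillings pointwise `((π−r)∕sin r)·μ`-close.
`W φ (i, j, l) := Wc (fun q ↦ φ (q.1, σ₂ q.2.1, σ₃ q.2.2)) (i, τ₂ j, τ₃ l)` over ✓`exists_coneOnCube n₁` and ✓`exists_stretch n₁ n₂`, ✓`exists_stretch n₁ n₃`.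
[cite: Balaban1985RegularSpaces, Thm 2 p.83] -/
theorem exists_coneOnBox (n₁ n₂ n₃ : ℕ) (hn₂ : 2 ≤ n₂) (hn₃ : 2 ≤ n₃) (h₂₁ : n₂ ≤ n₁) (h₁₂ : n₁ ≤ 2 * n₂) (h₃₁ : n₃ ≤ n₁) (h₁₃ : n₁ ≤ 2 * n₃)
    {r : ℝ} (hr : 0 < r) (hrπ : r < π) (a : SU2) :
    ∃ W : (ℕ × ℕ × ℕ → SU2) → (ℕ × ℕ × ℕ → SU2), ∀ φ : ℕ × ℕ × ℕ → SU2,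
      (∀ i j l, i ≤ n₁ → j ≤ n₂ → l ≤ n₃ → (i = 0 ∨ i = n₁ ∨ j = 0 ∨ j = n₂ ∨ l = 0 ∨ l = n₃) →
        ‖logVec (su2Quat (a⁻¹ * φ (i, j, l)))‖ ≤ π - r) →
      (∀ i j l, i ≤ n₁ → j ≤ n₂ → l ≤ n₃ → (i = 0 ∨ i = n₁ ∨ j = 0 ∨ j = n₂ ∨ l = 0 ∨ l = n₃) → W φ (i, j, l) = φ (i, j, l)) ∧
      (∀ i j l, i ≤ n₁ → j ≤ n₂ → l ≤ n₃ → ‖logVec (su2Quat (a⁻¹ * W φ (i, j, l)))‖ ≤ π - r) ∧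
      (∀ η : ℝ, 0 ≤ η →
        (∀ i j l, i + 1 ≤ n₁ → j ≤ n₂ → l ≤ n₃ → (i = 0 ∨ i = n₁ ∨ j = 0 ∨ j = n₂ ∨ l = 0 ∨ l = n₃) →
          (i + 1 = n₁ ∨ j = 0 ∨ j = n₂ ∨ l = 0 ∨ l = n₃) → dist1 (φ (i, j, l) * (φ (i + 1, j, l))⁻¹) ≤ η) →
        (∀ i j l, i ≤ n₁ → j + 1 ≤ n₂ → l ≤ n₃ → (i = 0 ∨ i = n₁ ∨ j = 0 ∨ j = n₂ ∨ l = 0 ∨ l = n₃) →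
          (i = 0 ∨ i = n₁ ∨ j + 1 = n₂ ∨ l = 0 ∨ l = n₃) → dist1 (φ (i, j, l) * (φ (i, j + 1, l))⁻¹) ≤ η) →
        (∀ i j l, i ≤ n₁ → j ≤ n₂ → l + 1 ≤ n₃ → (i = 0 ∨ i = n₁ ∨ j = 0 ∨ j = n₂ ∨ l = 0 ∨ l = n₃) →
          (i = 0 ∨ i = n₁ ∨ j = 0 ∨ j = n₂ ∨ l + 1 = n₃) → dist1 (φ (i, j, l) * (φ (i, j, l + 1))⁻¹) ≤ η) →
        (∀ i j l, i + 1 ≤ n₁ → j ≤ n₂ → l ≤ n₃ →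
          dist1 (W φ (i, j, l) * (W φ (i + 1, j, l))⁻¹) ≤ 24 * ((π - r) / Real.sin r) * η + 6 * (π - r) / n₁) ∧
        (∀ i j l, i ≤ n₁ → j + 1 ≤ n₂ → l ≤ n₃ →
          dist1 (W φ (i, j, l) * (W φ (i, j + 1, l))⁻¹) ≤ 24 * ((π - r) / Real.sin r) * η + 6 * (π - r) / n₁) ∧
        (∀ i j l, i ≤ n₁ → j ≤ n₂ → l + 1 ≤ n₃ →
          dist1 (W φ (i, j, l) * (W φ (i, j, l + 1))⁻¹) ≤ 24 * ((π - r) / Real.sin r) * η + 6 * (π - r) / n₁)) ∧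
      (∀ φ' : ℕ × ℕ × ℕ → SU2, ∀ μ : ℝ,
        (∀ i j l, i ≤ n₁ → j ≤ n₂ → l ≤ n₃ → (i = 0 ∨ i = n₁ ∨ j = 0 ∨ j = n₂ ∨ l = 0 ∨ l = n₃) →
          ‖logVec (su2Quat (a⁻¹ * φ' (i, j, l)))‖ ≤ π - r) →
        (∀ i j l, i ≤ n₁ → j ≤ n₂ → l ≤ n₃ → (i = 0 ∨ i = n₁ ∨ j = 0 ∨ j = n₂ ∨ l = 0 ∨ l = n₃) →
          dist1 (φ (i, j, l) * (φ' (i, j, l))⁻¹) ≤ μ) →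
        ∀ i j l, i ≤ n₁ → j ≤ n₂ → l ≤ n₃ → dist1 (W φ (i, j, l) * (W φ' (i, j, l))⁻¹) ≤ ((π - r) / Real.sin r) * μ) := by
  obtain ⟨σ₂, τ₂, h₂0, h₂a, h₂m, h₂s, h₂le, hτ₂0, hτ₂b, hτ₂m, hτ₂s, hτ₂le, hστ₂⟩ := exists_stretch n₁ n₂ (by omega) h₂₁ h₁₂
  obtain ⟨σ₃, τ₃, h₃0, h₃a, h₃m, h₃s, h₃le, hτ₃0, hτ₃b, hτ₃m, hτ₃s, hτ₃le, hστ₃⟩ := exists_stretch n₁ n₃ (by omega) h₃₁ h₁₃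
  have hn₁ : 2 ≤ n₁ := le_trans hn₂ h₂₁
  obtain ⟨Wc, hWc⟩ := exists_coneOnCube n₁ hn₁ hr hrπ a
  have hΛ0 : 0 ≤ (π - r) / Real.sin r := div_nonneg (by linarith) (Real.sin_nonneg_of_nonneg_of_le_pi hr.le hrπ.le)
  have hπr : 0 ≤ 3 * (π - r) / n₁ := div_nonneg (by linarith) (Nat.cast_nonneg _)
  -- the cube shell of the point `(i, τ₂ j, τ₃ l)` from the box shell of `(i, j, l)`
  have shellτ : ∀ i j l, (i = 0 ∨ i = n₁ ∨ j = 0 ∨ j = n₂ ∨ l = 0 ∨ l = n₃) → (i = 0 ∨ i = n₁ ∨ τ₂ j = 0 ∨ τ₂ j = n₁ ∨ τ₃ l = 0 ∨ τ₃ l = n₁) := by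
    intro i j l hb
    rcases hb with h | h | h | h | h | h
    · exact Or.inl h
    · exact Or.inr (Or.inl h)
    · exact Or.inr (Or.inr (Or.inl (by rw [h, hτ₂0])))
    · exact Or.inr (Or.inr (Or.inr (Or.inl (by rw [h, hτ₂b]))))
    · exact Or.inr (Or.inr (Or.inr (Or.inr (Or.inl (by rw [h, hτ₃0])))))
    · exact Or.inr (Or.inr (Or.inr (Or.inr (Or.inr (by rw [h, hτ₃b])))))
  -- cube shell cap of the pulled-back datum from the box's shell cap
  have capψ : ∀ φ : ℕ × ℕ × ℕ → SU2,
      (∀ i j l, i ≤ n₁ → j ≤ n₂ → l ≤ n₃ → (i = 0 ∨ i = n₁ ∨ j = 0 ∨ j = n₂ ∨ l = 0 ∨ l = n₃) →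
        ‖logVec (su2Quat (a⁻¹ * φ (i, j, l)))‖ ≤ π - r) →
      ∀ i k l, i ≤ n₁ → k ≤ n₁ → l ≤ n₁ → (i = 0 ∨ i = n₁ ∨ k = 0 ∨ k = n₁ ∨ l = 0 ∨ l = n₁) →
        ‖logVec (su2Quat (a⁻¹ * (fun q : ℕ × ℕ × ℕ => φ (q.1, σ₂ q.2.1, σ₃ q.2.2)) (i, k, l)))‖ ≤ π - r :=
    fun φ hcap i k l hi hk hl hb => hcap i (σ₂ k) (σ₃ l) hi (h₂le k hk) (h₃le l hl) (boxShell_of_cubeShell σ₂ σ₃ h₂0 h₂a h₃0 h₃a hb)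
  refine ⟨fun φ p => Wc (fun q : ℕ × ℕ × ℕ => φ (q.1, σ₂ q.2.1, σ₃ q.2.2)) (p.1, τ₂ p.2.1, τ₃ p.2.2), fun φ hcap => ?_⟩
  obtain ⟨h1, h2, h3, h4⟩ := hWc (fun q : ℕ × ℕ × ℕ => φ (q.1, σ₂ q.2.1, σ₃ q.2.2)) (capψ φ hcap)
  refine ⟨fun i j l hi hj hl hb => ?_, fun i j l hi hj hl => ?_, fun η hη H1 H2 H3 => ?_, fun φ' μ hcap' hclose i j l hi hj hl => ?_⟩
  · -- (i) shell agreement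
    show Wc (fun q : ℕ × ℕ × ℕ => φ (q.1, σ₂ q.2.1, σ₃ q.2.2)) (i, τ₂ j, τ₃ l) = φ (i, j, l)
    rw [h1 i (τ₂ j) (τ₃ l) hi (hτ₂le j hj) (hτ₃le l hl) (shellτ i j l hb)]
    show φ (i, σ₂ (τ₂ j), σ₃ (τ₃ l)) = φ (i, j, l)
    rw [hστ₂, hστ₃]
  · -- (ii) cap position
    exact h2 i (τ₂ j) (τ₃ l) hi (hτ₂le j hj) (hτ₃le l hl)
  · -- (iii′) steps from the per-bond shell letters: S0's modulus of the cube datum, S2 (iii), at most two cube steps per box step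
    have hadj := shellAdj_of_steps n₁ (fun q : ℕ × ℕ × ℕ => φ (q.1, σ₂ q.2.1, σ₃ q.2.2))
      (cubeShell_h1_of_box n₁ n₂ n₃ φ σ₂ σ₃ h₂0 h₂a h₂le h₃0 h₃a h₃le H1)
      (cubeShell_h2_of_box n₁ n₂ n₃ hn₁ φ σ₂ σ₃ h₂m h₂s h₂le h₃0 h₃a h₃le hη H2)
      (cubeShell_h3_of_box n₁ n₂ n₃ hn₁ φ σ₂ σ₃ h₂0 h₂a h₂le h₃m h₃s h₃le hη H3)
    obtain ⟨hs1, hs2, hs3⟩ := h3 (2 * η) (by positivity) (dist1_shell_le_two_mul_l1 n₁ _ hη hadj)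
    have hB0 : 0 ≤ 6 * ((π - r) / Real.sin r) * (2 * η) + 3 * (π - r) / n₁ := add_nonneg (by positivity) hπr
    have hBB : (2 : ℝ) * (6 * ((π - r) / Real.sin r) * (2 * η) + 3 * (π - r) / n₁) = 24 * ((π - r) / Real.sin r) * η + 6 * (π - r) / n₁ := by
      ring
    refine ⟨fun i j l hi hj hl => ?_, fun i j l hi hj hl => ?_, fun i j l hi hj hl => ?_⟩
    · -- first direction: one cube step at `(i, τ₂ j, τ₃ l)`
      show dist1 (Wc (fun q : ℕ × ℕ × ℕ => φ (q.1, σ₂ q.2.1, σ₃ q.2.2)) (i, τ₂ j, τ₃ l) *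
        (Wc (fun q : ℕ × ℕ × ℕ => φ (q.1, σ₂ q.2.1, σ₃ q.2.2)) (i + 1, τ₂ j, τ₃ l))⁻¹) ≤ _
      rw [← hBB]
      linarith [hs1 i (τ₂ j) (τ₃ l) hi (hτ₂le j hj) (hτ₃le l hl)]
    · -- second direction: at most two cube steps from `τ₂ j` to `τ₂ (j+1)`
      show dist1 (Wc (fun q : ℕ × ℕ × ℕ => φ (q.1, σ₂ q.2.1, σ₃ q.2.2)) (i, τ₂ j, τ₃ l) *
        (Wc (fun q : ℕ × ℕ × ℕ => φ (q.1, σ₂ q.2.1, σ₃ q.2.2)) (i, τ₂ (j + 1), τ₃ l))⁻¹) ≤ _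
      rw [← hBB]
      have hτj1 : τ₂ (j + 1) ≤ n₁ := hτ₂le (j + 1) hj
      refine dist1_two_steps_le (fun v => Wc (fun q : ℕ × ℕ × ℕ => φ (q.1, σ₂ q.2.1, σ₃ q.2.2)) (i, v, τ₃ l)) hB0 (τ₂ j) (τ₂ (j + 1))
        (by have := hτ₂m j; have := hτ₂s j; omega) (fun hc => ?_) (fun hc => ?_)
      · exact hs2 i (τ₂ j) (τ₃ l) hi (by omega) (hτ₃le l hl)
      · have h' := hs2 i (τ₂ j + 1) (τ₃ l) hi (by omega) (hτ₃le l hl)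
        simpa [add_assoc] using h'
    · -- third direction: at most two cube steps from `τ₃ l` to `τ₃ (l+1)`
      show dist1 (Wc (fun q : ℕ × ℕ × ℕ => φ (q.1, σ₂ q.2.1, σ₃ q.2.2)) (i, τ₂ j, τ₃ l) *
        (Wc (fun q : ℕ × ℕ × ℕ => φ (q.1, σ₂ q.2.1, σ₃ q.2.2)) (i, τ₂ j, τ₃ (l + 1)))⁻¹) ≤ _
      rw [← hBB]
      have hτl1 : τ₃ (l + 1) ≤ n₁ := hτ₃le (l + 1) hl
      refine dist1_two_steps_le (fun v => Wc (fun q : ℕ × ℕ × ℕ => φ (q.1, σ₂ q.2.1, σ₃ q.2.2)) (i, τ₂ j, v)) hB0 (τ₃ l) (τ₃ (l + 1))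
        (by have := hτ₃m l; have := hτ₃s l; omega) (fun hc => ?_) (fun hc => ?_)
      · exact hs3 i (τ₂ j) (τ₃ l) hi (hτ₂le j hj) (by omega)
      · have h' := hs3 i (τ₂ j) (τ₃ l + 1) hi (hτ₂le j hj) (by omega)
        simpa [add_assoc] using h'
  · -- (iv) datum to datum
    exact h4 (fun q : ℕ × ℕ × ℕ => φ' (q.1, σ₂ q.2.1, σ₃ q.2.2)) μ (capψ φ' hcap')
      (fun i' k l' hi' hk hl' hb => hclose i' (σ₂ k) (σ₃ l') hi' (h₂le k hk) (h₃le l' hl') (boxShell_of_cubeShell σ₂ σ₃ h₂0 h₂a h₃0 h₃a hb))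
      i (τ₂ j) (τ₃ l) hi (hτ₂le j hj) (hτ₃le l hl)

end Summit.QuantumFields.YangMills.Theorems.FluctuationComparisonRegPrIntLS2BetaConeOnBox

end
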